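import Literature.AlgebraicGeometry.ShimuraVarieties.UnitaryBallRationalSubconeDensityGeneralRank
import HarnessLib

/-!
# The invariant majorant of a negative vector and the TWO-POINT BOUND for isometries of a hermitian form of signature `(p,1)`
# (every rank `p`, cone coordinates)

Topic `AlgebraicGeometry/ShimuraVarieties`, namespace `Literature.AlgebraicGeometry.ShimuraVarieties`, dotted on
`D : UnitaryBallUniformisationDatum p X` (★ `UnitaryBallQuotientDatum.lean`: CM field `E ⊆ ℂ`, anisotropic hermitian `H` on `E^{p+1}` of
signature `(p,1)` at `τ₁`, congruence subgroup `Γ ≤ U(H)(E)`, uniformisation of `X(ℂ)` by the negative cone of `H^{τ₁}`).  THEOREMS ONLY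
(no definition, no named fact, no instance, no `sorry`).  Part 1 of 2 of the rank-generic, frame-free form of ★ `UnitaryBallDiscontinuity`
(there: `p = 2`, ball model `𝔹²`, `U(2,1)`, Sylvester frame, ★ `BallModel.exists_norm_entry_le_of_isCompact`); part 2 =
`UnitaryConeDiscontinuity` (discreteness, freeness, local injectivity of `unif` modulo `ℂˣ`).

* §1 the INVARIANT MAJORANT of a negative vector `v`: `m_v(x) = Re⟪x,x⟫ + 2‖⟪v,x⟫‖²/(−Re⟪v,v⟫)` (`⟪x,y⟫ = x̄ᵀ H^{τ₁} y`) is a positive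
  definite real quadratic form (`v^⊥` is positive definite in signature `(p,1)` — ★
  `RationalSubconeGeneralRank.re_hermForm_self_pos_of_orthogonal_of_mem_negCone`), with `m_{gv}(gx) = m_v(x)` for isometries `g` and
  `m_{cv} = m_v` (`c ≠ 0`): it is the classical hermitian majorant `⟪·,·⟫|_{v^⊥} ⊕ (−⟪·,·⟫)|_{ℂv}` of the indefinite form;
* §2 COMPACT COMPARISON: on a compact `K ⊆ negCone`, `λ‖x‖² ≤ m_v(x) ≤ Λ‖x‖²` with `0 < λ` (extrema on `K × sphere`);
* §3 the TWO-POINT BOUND: an isometry `g` of `H^{τ₁}` carrying a vector of `K` to a non-zero multiple of a vector of `K` has all its entries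
  of norm `≤ √(Λ/λ)` (`λ‖gx‖² ≤ m_w(gx) = m_{cw}(gx) = m_{gv}(gx) = m_v(x) ≤ Λ‖x‖²`); for `γ ∈ Γ` this bounds `‖τ₁(γᵢⱼ)‖`.
All statements are about the EXPLICIT expression `m_v(x)` (no `def`).

## References
* [Borel1969] A. Borel, *Introduction aux groupes arithmétiques*, Hermann 1969, §1 and Prop. 7.13 (the compactness behind the two-point bound; the majorant is the classical Hermite–Siegel device).
* [BergeronMillsonMoeglin2016Balls] N. Bergeron, J. Millson, C. Moeglin, Acta Math. 216 (2016), Part 2 §§1.2–1.3.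
* Tree: ★ `UnitaryBallDiscontinuity` (`p = 2`), ★ `UnitaryBallRationalSubconeDensityGeneralRank` (positivity of `v^⊥`).
-/

set_option autoImplicit false

noncomputable section

open Matrix Complex NumberField Topology Set
open scoped ComplexOrder ComplexConjugate

namespace Literature.AlgebraicGeometry.ShimuraVarieties

namespace UnitaryBallUniformisationDatum

open Literature.AlgebraicGeometry.Motives (SchemeOver)

variable {p : ℕ} {X : SchemeOver ℂ} (D : UnitaryBallUniformisationDatum p X)

/-! ### §0 Sesquilinear plumbing for `⟪x, y⟫ = star x ⬝ᵥ (H^{τ₁} *ᵥ y)` -/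

section Plumbing

variable {m : Type*} [Fintype m] (Hc : Matrix m m ℂ)

/-- `⟪u, v + v'⟫ = ⟪u, v⟫ + ⟪u, v'⟫`. [folklore] -/
private theorem form_add_right (u v v' : m → ℂ) :
    star u ⬝ᵥ (Hc *ᵥ (v + v')) = star u ⬝ᵥ (Hc *ᵥ v) + star u ⬝ᵥ (Hc *ᵥ v') := by
  rw [mulVec_add, dotProduct_add]

/-- `⟪u, v - v'⟫ = ⟪u, v⟫ - ⟪u, v'⟫`. [folklore] -/
private theorem form_sub_right (u v v' : m → ℂ) :
    star u ⬝ᵥ (Hc *ᵥ (v - v')) = star u ⬝ᵥ (Hc *ᵥ v) - star u ⬝ᵥ (Hc *ᵥ v') := by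
  rw [mulVec_sub, dotProduct_sub]

/-- `⟪u, c • v⟫ = c ⟪u, v⟫`. [folklore] -/
private theorem form_smul_right (c : ℂ) (u v : m → ℂ) :
    star u ⬝ᵥ (Hc *ᵥ (c • v)) = c * (star u ⬝ᵥ (Hc *ᵥ v)) := by
  rw [mulVec_smul, dotProduct_smul, smul_eq_mul]

/-- `⟪u + u', w⟫ = ⟪u, w⟫ + ⟪u', w⟫`. [folklore] -/
private theorem form_add_left (u u' w : m → ℂ) :
    star (u + u') ⬝ᵥ (Hc *ᵥ w) = star u ⬝ᵥ (Hc *ᵥ w) + star u' ⬝ᵥ (Hc *ᵥ w) := by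
  rw [star_add, add_dotProduct]

/-- `⟪c • u, w⟫ = c̄ ⟪u, w⟫`. [folklore] -/
private theorem form_smul_left (c : ℂ) (u w : m → ℂ) :
    star (c • u) ⬝ᵥ (Hc *ᵥ w) = conj c * (star u ⬝ᵥ (Hc *ᵥ w)) := by
  rw [star_smul, smul_dotProduct, smul_eq_mul, Complex.star_def]

/-- `⟪0, w⟫ = 0` and `⟪u, 0⟫ = 0`. [folklore] -/
private theorem form_zero_right (u : m → ℂ) : star u ⬝ᵥ (Hc *ᵥ (0 : m → ℂ)) = 0 := by
  rw [mulVec_zero, dotProduct_zero]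

/-- Hermitian symmetry `conj ⟪u, v⟫ = ⟪v, u⟫` for a hermitian Gram matrix. [folklore] -/
private theorem conj_form {Hc : Matrix m m ℂ} (hH : Hc.IsHermitian) (u v : m → ℂ) :
    conj (star u ⬝ᵥ (Hc *ᵥ v)) = star v ⬝ᵥ (Hc *ᵥ u) := by
  rw [← Complex.star_def, dotProduct_mulVec, ← star_dotProduct_star, star_vecMul, star_star, hH.eq]

/-- `⟪v, v⟫` is real for a hermitian Gram matrix: `⟪v, v⟫ = Re⟪v, v⟫`. [folklore] -/
private theorem form_self_eq_re {Hc : Matrix m m ℂ} (hH : Hc.IsHermitian) (v : m → ℂ) :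
    star v ⬝ᵥ (Hc *ᵥ v) = ((star v ⬝ᵥ (Hc *ᵥ v)).re : ℂ) :=
  (Complex.conj_eq_iff_re.1 (conj_form hH v v)).symm ▸ rfl

/-- Isometries preserve the form: `gᴴ Hc g = Hc ⇒ ⟪g x, g y⟫ = ⟪x, y⟫`. [cite: BergeronMillsonMoeglin2016Balls, Part 2 §1.2] -/
private theorem form_mulVec_mulVec {G : Matrix m m ℂ} (hG : Gᴴ * Hc * G = Hc) (x y : m → ℂ) :
    star (G *ᵥ x) ⬝ᵥ (Hc *ᵥ (G *ᵥ y)) = star x ⬝ᵥ (Hc *ᵥ y) := by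
  rw [star_mulVec, mulVec_mulVec, dotProduct_mulVec, vecMul_vecMul, ← Matrix.mul_assoc, hG, ← dotProduct_mulVec]

/-- `Re⟪c • v, c • v⟫ = ‖c‖² Re⟪v, v⟫`. [folklore] -/
private theorem re_form_smul_smul (c : ℂ) (v : m → ℂ) :
    (star (c • v) ⬝ᵥ (Hc *ᵥ (c • v))).re = ‖c‖ ^ 2 * (star v ⬝ᵥ (Hc *ᵥ v)).re := by
  rw [form_smul_left, form_smul_right, ← mul_assoc, ← Complex.normSq_eq_conj_mul_self, Complex.re_ofReal_mul,
    Complex.normSq_eq_norm_sq]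

end Plumbing

/-! ### §1 The invariant majorant of a negative vector -/

/-- **`v^⊥` is positive definite** for a negative vector `v` of `V_{τ₁}` (signature `(p,1)`): if `⟪v, w⟫ = 0` and `w ≠ 0` then
`Re⟪w, w⟫ > 0` — ★ `RationalSubconeGeneralRank.re_hermForm_self_pos_of_orthogonal_of_mem_negCone` in the datum's Sylvester frame
`signature_τ₁`. [cite: BergeronMillsonMoeglin2016Balls, Part 2 §1.3] -/
theorem re_form_self_pos_of_orthogonal {v w : Fin (p + 1) → ℂ} (hv : v ∈ D.cone) (hw : w ≠ 0)
    (horth : star v ⬝ᵥ (D.Hℂ *ᵥ w) = 0) : 0 < (star w ⬝ᵥ (D.Hℂ *ᵥ w)).re := by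
  obtain ⟨T, hT⟩ := D.signature_τ₁
  exact RationalSubconeGeneralRank.re_hermForm_self_pos_of_orthogonal_of_mem_negCone hT T.mul_inv hv hw horth

/-- A negative vector has `Re⟪v, v⟫ < 0`, so `−Re⟪v, v⟫ > 0`. [cite: BergeronMillsonMoeglin2016Balls, Part 2 §1.3] -/
theorem neg_re_form_self_pos {v : Fin (p + 1) → ℂ} (hv : v ∈ D.cone) : 0 < -(star v ⬝ᵥ (D.Hℂ *ᵥ v)).re :=
  neg_pos.2 (mem_negCone_iff.1 hv)

/-- A negative vector has `⟪v, v⟫ ≠ 0`. [folklore] -/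
private theorem form_self_ne_zero_of_mem_cone {v : Fin (p + 1) → ℂ} (hv : v ∈ D.cone) : star v ⬝ᵥ (D.Hℂ *ᵥ v) ≠ 0 := by
  intro h
  have := D.neg_re_form_self_pos hv
  rw [h, Complex.zero_re, neg_zero] at this
  exact lt_irrefl 0 this

/-- **The majorant of a negative vector is positive definite**: for `v` negative and `x ≠ 0`,
`Re⟪x,x⟫ + 2‖⟪v,x⟫‖² / (−Re⟪v,v⟫) > 0`.  (Split `x = a v + x'` with `x' ⟂ v`, `a = ⟪v,x⟫/⟪v,v⟫`: the expression equals
`‖a‖²(−Re⟪v,v⟫) + Re⟪x',x'⟫`, and `v^⊥` is positive definite.) [cite: BergeronMillsonMoeglin2016Balls, Part 2 §1.3] -/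
theorem majorant_pos {v x : Fin (p + 1) → ℂ} (hv : v ∈ D.cone) (hx : x ≠ 0) :
    0 < (star x ⬝ᵥ (D.Hℂ *ᵥ x)).re + 2 * ‖star v ⬝ᵥ (D.Hℂ *ᵥ x)‖ ^ 2 / (-(star v ⬝ᵥ (D.Hℂ *ᵥ v)).re) := by
  have hH := D.isHermitian_Hℂ
  have hq := D.neg_re_form_self_pos hv
  have hvv := D.form_self_ne_zero_of_mem_cone hv
  have hvvr : star v ⬝ᵥ (D.Hℂ *ᵥ v) = ((star v ⬝ᵥ (D.Hℂ *ᵥ v)).re : ℂ) := form_self_eq_re hH v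
  set a : ℂ := star v ⬝ᵥ (D.Hℂ *ᵥ x) / star v ⬝ᵥ (D.Hℂ *ᵥ v) with ha
  set x' : Fin (p + 1) → ℂ := x - a • v with hx'
  have hvx : star v ⬝ᵥ (D.Hℂ *ᵥ x) = a * star v ⬝ᵥ (D.Hℂ *ᵥ v) := by
    rw [ha, div_mul_cancel₀ _ hvv]
  have horth : star v ⬝ᵥ (D.Hℂ *ᵥ x') = 0 := by
    rw [hx', form_sub_right, form_smul_right, hvx, sub_self]
  have horth' : star x' ⬝ᵥ (D.Hℂ *ᵥ v) = 0 := by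
    rw [← conj_form hH v x', horth, map_zero]
  have hxdec : x = a • v + x' := by rw [hx']; abel
  -- `Re⟪x,x⟫ = ‖a‖² Re⟪v,v⟫ + Re⟪x',x'⟫`
  have hxx : (star x ⬝ᵥ (D.Hℂ *ᵥ x)).re = ‖a‖ ^ 2 * (star v ⬝ᵥ (D.Hℂ *ᵥ v)).re + (star x' ⬝ᵥ (D.Hℂ *ᵥ x')).re := by
    conv_lhs => rw [hxdec]
    rw [form_add_left, form_add_right, form_add_right, form_smul_right D.Hℂ a x' v, horth', mul_zero, zero_add,
      form_smul_left D.Hℂ a v x', horth, mul_zero, add_zero, Complex.add_re, re_form_smul_smul]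
  -- `‖⟪v,x⟫‖² = ‖a‖² (Re⟪v,v⟫)²`
  have hvx2 : ‖star v ⬝ᵥ (D.Hℂ *ᵥ x)‖ ^ 2 = ‖a‖ ^ 2 * (star v ⬝ᵥ (D.Hℂ *ᵥ v)).re ^ 2 := by
    rw [hvx, norm_mul, mul_pow, hvvr, Complex.norm_real, Real.norm_eq_abs, sq_abs, Complex.ofReal_re]
  have hr0 : (star v ⬝ᵥ (D.Hℂ *ᵥ v)).re ≠ 0 := fun h ↦ by rw [h, neg_zero] at hq; exact lt_irrefl 0 hq
  have key : (star x ⬝ᵥ (D.Hℂ *ᵥ x)).re + 2 * ‖star v ⬝ᵥ (D.Hℂ *ᵥ x)‖ ^ 2 / (-(star v ⬝ᵥ (D.Hℂ *ᵥ v)).re) =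
      ‖a‖ ^ 2 * (-(star v ⬝ᵥ (D.Hℂ *ᵥ v)).re) + (star x' ⬝ᵥ (D.Hℂ *ᵥ x')).re := by
    rw [hxx, hvx2]
    field_simp
    ring
  rw [key]
  by_cases hx'0 : x' = 0
  · -- then `x = a • v` with `a ≠ 0`
    have ha0 : a ≠ 0 := by
      rintro ha0
      apply hx
      rw [hxdec, hx'0, ha0, zero_smul, add_zero]
    rw [hx'0, form_zero_right, Complex.zero_re, add_zero]
    exact mul_pos (pow_pos (norm_pos_iff.2 ha0) 2) hq
  · have hpos := D.re_form_self_pos_of_orthogonal hv hx'0 horth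
    have h0 : 0 ≤ ‖a‖ ^ 2 * (-(star v ⬝ᵥ (D.Hℂ *ᵥ v)).re) := mul_nonneg (sq_nonneg _) hq.le
    linarith

/-- The majorant only depends on the LINE of `v`: `m_{cv} = m_v` for `c ≠ 0`. [folklore] -/
private theorem majorant_smul_left {c : ℂ} (hc : c ≠ 0) (v x : Fin (p + 1) → ℂ) :
    (star x ⬝ᵥ (D.Hℂ *ᵥ x)).re + 2 * ‖star (c • v) ⬝ᵥ (D.Hℂ *ᵥ x)‖ ^ 2 / (-(star (c • v) ⬝ᵥ (D.Hℂ *ᵥ (c • v))).re) =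
      (star x ⬝ᵥ (D.Hℂ *ᵥ x)).re + 2 * ‖star v ⬝ᵥ (D.Hℂ *ᵥ x)‖ ^ 2 / (-(star v ⬝ᵥ (D.Hℂ *ᵥ v)).re) := by
  have hc2 : (‖c‖ ^ 2 : ℝ) ≠ 0 := pow_ne_zero 2 (norm_ne_zero_iff.2 hc)
  rw [form_smul_left, norm_mul, Complex.norm_conj, mul_pow, re_form_smul_smul, neg_mul_eq_mul_neg, mul_left_comm (2 : ℝ),
    mul_div_mul_left _ _ hc2]

/-- The majorant is invariant under isometries: `m_{gv}(gx) = m_v(x)` for `gᴴ Hc g = Hc`. [cite: BergeronMillsonMoeglin2016Balls, Part 2 §§1.2–1.3] -/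
theorem majorant_mulVec {G : Matrix (Fin (p + 1)) (Fin (p + 1)) ℂ} (hG : Gᴴ * D.Hℂ * G = D.Hℂ) (v x : Fin (p + 1) → ℂ) :
    (star (G *ᵥ x) ⬝ᵥ (D.Hℂ *ᵥ (G *ᵥ x))).re +
        2 * ‖star (G *ᵥ v) ⬝ᵥ (D.Hℂ *ᵥ (G *ᵥ x))‖ ^ 2 / (-(star (G *ᵥ v) ⬝ᵥ (D.Hℂ *ᵥ (G *ᵥ v))).re) =
      (star x ⬝ᵥ (D.Hℂ *ᵥ x)).re + 2 * ‖star v ⬝ᵥ (D.Hℂ *ᵥ x)‖ ^ 2 / (-(star v ⬝ᵥ (D.Hℂ *ᵥ v)).re) := by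
  rw [form_mulVec_mulVec D.Hℂ hG, form_mulVec_mulVec D.Hℂ hG, form_mulVec_mulVec D.Hℂ hG]

/-- Homogeneity in `x`: `m_v(t • x) = ‖t‖² m_v(x)`. [folklore] -/
private theorem majorant_smul_right (t : ℂ) (v x : Fin (p + 1) → ℂ) :
    (star (t • x) ⬝ᵥ (D.Hℂ *ᵥ (t • x))).re + 2 * ‖star v ⬝ᵥ (D.Hℂ *ᵥ (t • x))‖ ^ 2 / (-(star v ⬝ᵥ (D.Hℂ *ᵥ v)).re) =
      ‖t‖ ^ 2 * ((star x ⬝ᵥ (D.Hℂ *ᵥ x)).re + 2 * ‖star v ⬝ᵥ (D.Hℂ *ᵥ x)‖ ^ 2 / (-(star v ⬝ᵥ (D.Hℂ *ᵥ v)).re)) := by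
  rw [re_form_smul_smul, form_smul_right, norm_mul, mul_pow]
  ring

/-! ### §2 Compact comparison `λ‖x‖² ≤ m_v(x) ≤ Λ‖x‖²` -/

/-- The majorant `(v, x) ↦ m_v(x)` is continuous on `negCone × ℂ^{p+1}`. [folklore] -/
private theorem continuousOn_majorant :
    ContinuousOn (fun z : (Fin (p + 1) → ℂ) × (Fin (p + 1) → ℂ) ↦
      (star z.2 ⬝ᵥ (D.Hℂ *ᵥ z.2)).re + 2 * ‖star z.1 ⬝ᵥ (D.Hℂ *ᵥ z.2)‖ ^ 2 / (-(star z.1 ⬝ᵥ (D.Hℂ *ᵥ z.1)).re))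
      (D.cone ×ˢ univ) := by
  have hform : ∀ {f g : (Fin (p + 1) → ℂ) × (Fin (p + 1) → ℂ) → (Fin (p + 1) → ℂ)}, Continuous f → Continuous g →
      Continuous fun z ↦ star (f z) ⬝ᵥ (D.Hℂ *ᵥ g z) := fun hf hg ↦
    (continuous_star.comp hf).dotProduct (continuous_const.matrix_mulVec hg)
  have h1 : Continuous fun z : (Fin (p + 1) → ℂ) × (Fin (p + 1) → ℂ) ↦ (star z.2 ⬝ᵥ (D.Hℂ *ᵥ z.2)).re :=
    Complex.continuous_re.comp (hform continuous_snd continuous_snd)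
  have h2 : Continuous fun z : (Fin (p + 1) → ℂ) × (Fin (p + 1) → ℂ) ↦ 2 * ‖star z.1 ⬝ᵥ (D.Hℂ *ᵥ z.2)‖ ^ 2 :=
    continuous_const.mul ((continuous_norm.comp (hform continuous_fst continuous_snd)).pow 2)
  have h3 : Continuous fun z : (Fin (p + 1) → ℂ) × (Fin (p + 1) → ℂ) ↦ -(star z.1 ⬝ᵥ (D.Hℂ *ᵥ z.1)).re :=
    (Complex.continuous_re.comp (hform continuous_fst continuous_fst)).neg
  refine h1.continuousOn.add ((h2.continuousOn).div h3.continuousOn fun z hz ↦ ?_)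
  exact (D.neg_re_form_self_pos (mem_prod.1 hz).1).ne'

/-- **Compact comparison**: on a compact set `K` of negative vectors the majorants are uniformly equivalent to the sup norm:
`λ‖x‖² ≤ m_v(x) ≤ Λ‖x‖²` for all `v ∈ K`, `x ∈ ℂ^{p+1}`, with `0 < λ`. [cite: BergeronMillsonMoeglin2016Balls, Part 2 §1.3] [cite: Borel1969, Prop. 7.13] -/
theorem exists_majorant_bounds {K : Set (Fin (p + 1) → ℂ)} (hK : IsCompact K) (hKc : K ⊆ D.cone) (hne : K.Nonempty) :
    ∃ lam Λ : ℝ, 0 < lam ∧ ∀ v ∈ K, ∀ x : Fin (p + 1) → ℂ,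
      lam * ‖x‖ ^ 2 ≤ (star x ⬝ᵥ (D.Hℂ *ᵥ x)).re + 2 * ‖star v ⬝ᵥ (D.Hℂ *ᵥ x)‖ ^ 2 / (-(star v ⬝ᵥ (D.Hℂ *ᵥ v)).re) ∧
      (star x ⬝ᵥ (D.Hℂ *ᵥ x)).re + 2 * ‖star v ⬝ᵥ (D.Hℂ *ᵥ x)‖ ^ 2 / (-(star v ⬝ᵥ (D.Hℂ *ᵥ v)).re) ≤ Λ * ‖x‖ ^ 2 := by
  set f : (Fin (p + 1) → ℂ) × (Fin (p + 1) → ℂ) → ℝ := fun z ↦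
    (star z.2 ⬝ᵥ (D.Hℂ *ᵥ z.2)).re + 2 * ‖star z.1 ⬝ᵥ (D.Hℂ *ᵥ z.2)‖ ^ 2 / (-(star z.1 ⬝ᵥ (D.Hℂ *ᵥ z.1)).re) with hf
  set S : Set (Fin (p + 1) → ℂ) := Metric.sphere 0 1 with hS
  have hSc : IsCompact S := isCompact_sphere 0 1
  have hKS : IsCompact (K ×ˢ S) := hK.prod hSc
  obtain ⟨v₀, hv₀⟩ := hne
  obtain ⟨u₀, hu₀⟩ : S.Nonempty := NormedSpace.sphere_nonempty.2 zero_le_one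
  have hKSne : (K ×ˢ S).Nonempty := ⟨(v₀, u₀), mk_mem_prod hv₀ hu₀⟩
  have hsub : K ×ˢ S ⊆ D.cone ×ˢ univ := prod_mono hKc (subset_univ _)
  have hcont : ContinuousOn f (K ×ˢ S) := D.continuousOn_majorant.mono hsub
  obtain ⟨zm, hzm, hmin⟩ := hKS.exists_isMinOn hKSne hcont
  obtain ⟨zM, hzM, hmax⟩ := hKS.exists_isMaxOn hKSne hcont
  have hS1 : ∀ u ∈ S, ‖u‖ = 1 := fun u hu ↦ by simpa [hS] using hu
  have hSne0 : ∀ u ∈ S, u ≠ 0 := fun u hu h ↦ by have := hS1 u hu; rw [h, norm_zero] at this; exact zero_ne_one this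
  refine ⟨f zm, f zM, D.majorant_pos (hKc (mem_prod.1 hzm).1) (hSne0 _ (mem_prod.1 hzm).2), fun v hv x ↦ ?_⟩
  by_cases hx : x = 0
  · subst hx
    simp only [norm_zero, ne_eq, OfNat.ofNat_ne_zero, not_false_eq_true, zero_pow, mul_zero, form_zero_right, Complex.zero_re,
      zero_div, add_zero, le_refl, and_self]
  · -- normalise `x` to the unit sphere
    have hxn : ‖x‖ ≠ 0 := norm_ne_zero_iff.2 hx
    set u : Fin (p + 1) → ℂ := ((‖x‖⁻¹ : ℝ) : ℂ) • x with hu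
    have hun : ‖u‖ = 1 := by
      rw [hu, norm_smul, Complex.norm_real, norm_inv, norm_norm, inv_mul_cancel₀ hxn]
    have huS : u ∈ S := by simpa [hS] using hun
    have hxu : x = ((‖x‖ : ℝ) : ℂ) • u := by
      rw [hu, smul_smul, ← Complex.ofReal_mul, mul_inv_cancel₀ hxn, Complex.ofReal_one, one_smul]
    have hmem : (v, u) ∈ K ×ˢ S := mk_mem_prod hv huS
    have hlo : f zm ≤ f (v, u) := hmin hmem
    have hhi : f (v, u) ≤ f zM := hmax hmem
    have hfx : (star x ⬝ᵥ (D.Hℂ *ᵥ x)).re + 2 * ‖star v ⬝ᵥ (D.Hℂ *ᵥ x)‖ ^ 2 / (-(star v ⬝ᵥ (D.Hℂ *ᵥ v)).re) =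
        ‖x‖ ^ 2 * f (v, u) := by
      conv_lhs => rw [hxu]
      rw [D.majorant_smul_right, Complex.norm_real, norm_norm]
    rw [hfx]
    have hx2 : 0 ≤ ‖x‖ ^ 2 := sq_nonneg _
    constructor
    · rw [mul_comm]; exact mul_le_mul_of_nonneg_left hlo hx2
    · rw [mul_comm (f zM)]; exact mul_le_mul_of_nonneg_left hhi hx2

/-! ### §3 The two-point bound in cone coordinates -/

/-- **Two-point bound** (any rank, cone coordinates): for a compact set `K` of negative vectors there is `R` such that every isometry
`g` of `H^{τ₁}` carrying SOME vector of `K` to a non-zero multiple of SOME vector of `K` has all its entries of norm `≤ R`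
(`λ‖g x‖² ≤ m_w(gx) = m_{cw}(gx) = m_{gv}(gx) = m_v(x) ≤ Λ‖x‖²`). [cite: Borel1969, Prop. 7.13] -/
theorem exists_norm_entry_le_of_mulVec_eq_smul {K : Set (Fin (p + 1) → ℂ)} (hK : IsCompact K) (hKc : K ⊆ D.cone)
    (hne : K.Nonempty) :
    ∃ R : ℝ, ∀ G : Matrix (Fin (p + 1)) (Fin (p + 1)) ℂ, Gᴴ * D.Hℂ * G = D.Hℂ →
      (∃ v ∈ K, ∃ w ∈ K, ∃ c : ℂ, c ≠ 0 ∧ G *ᵥ v = c • w) → ∀ i j, ‖G i j‖ ≤ R := by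
  obtain ⟨lam, Λ, hlam, hb⟩ := D.exists_majorant_bounds hK hKc hne
  refine ⟨Real.sqrt (Λ / lam), fun G hG ⟨v, hv, w, hw, c, hc, hGv⟩ i j ↦ ?_⟩
  -- the bound `‖G x‖² ≤ (Λ/λ)‖x‖²` for every `x`
  have hGx : ∀ x : Fin (p + 1) → ℂ, ‖G *ᵥ x‖ ^ 2 ≤ Λ / lam * ‖x‖ ^ 2 := by
    intro x
    have h1 := (hb w hw (G *ᵥ x)).1
    have h2 := (hb v hv x).2
    have hmid : (star (G *ᵥ x) ⬝ᵥ (D.Hℂ *ᵥ (G *ᵥ x))).re +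
          2 * ‖star w ⬝ᵥ (D.Hℂ *ᵥ (G *ᵥ x))‖ ^ 2 / (-(star w ⬝ᵥ (D.Hℂ *ᵥ w)).re) =
        (star x ⬝ᵥ (D.Hℂ *ᵥ x)).re + 2 * ‖star v ⬝ᵥ (D.Hℂ *ᵥ x)‖ ^ 2 / (-(star v ⬝ᵥ (D.Hℂ *ᵥ v)).re) := by
      rw [← D.majorant_smul_left hc w (G *ᵥ x), ← hGv, D.majorant_mulVec hG]
    rw [hmid] at h1
    rw [div_mul_eq_mul_div, le_div_iff₀ hlam]
    calc ‖G *ᵥ x‖ ^ 2 * lam = lam * ‖G *ᵥ x‖ ^ 2 := mul_comm _ _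
      _ ≤ Λ * ‖x‖ ^ 2 := h1.trans h2
  have hcol := hGx (Pi.single j 1)
  rw [Pi.norm_single, norm_one, one_pow, mul_one, mulVec_single_one] at hcol
  have hij : ‖G i j‖ ≤ ‖G.col j‖ := norm_le_pi_norm (G.col j) i
  have hnn : 0 ≤ Λ / lam := by
    have := (sq_nonneg ‖G.col j‖).trans hcol
    exact this
  calc ‖G i j‖ ≤ ‖G.col j‖ := hij
    _ = Real.sqrt (‖G.col j‖ ^ 2) := (Real.sqrt_sq (norm_nonneg _)).symm
    _ ≤ Real.sqrt (Λ / lam) := Real.sqrt_le_sqrt hcol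

/-- The two-point bound for elements of `Γ` acting through `τ₁`. [cite: Borel1969, Prop. 7.13] -/
theorem exists_norm_τ₁_apply_le_of_act_eq_smul {K : Set (Fin (p + 1) → ℂ)} (hK : IsCompact K) (hKc : K ⊆ D.cone)
    (hne : K.Nonempty) :
    ∃ R : ℝ, ∀ γ : D.Γ, (∃ v ∈ K, ∃ w ∈ K, ∃ c : ℂ, c ≠ 0 ∧ D.act γ v = c • w) →
      ∀ i j, ‖D.τ₁ (((γ : GL (Fin (p + 1)) D.E) : Matrix (Fin (p + 1)) (Fin (p + 1)) D.E) i j)‖ ≤ R := by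
  obtain ⟨R, hR⟩ := D.exists_norm_entry_le_of_mulVec_eq_smul hK hKc hne
  refine ⟨R, fun γ hγ i j ↦ ?_⟩
  have h := hR _ (D.conjTranspose_mul_Hℂ_mul (D.isCongruenceSubgroup.1 γ.2)) hγ i j
  rwa [Matrix.map_apply] at h

end UnitaryBallUniformisationDatum

end Literature.AlgebraicGeometry.ShimuraVarieties

end
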